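import Summits.ResolutionOfSingularities.ResolutionOfSingularities.Theorems.WildConesCampaignW46HypersurfacesCharTwoNearPointExists

/-!
# [OURS · L1 W4.6, rung (ii) at p = 2, EVERY dimension n] THE SINGULAR BRANCH: from an isolated double
# point with curvilinear Milnor algebra (`e = 1`) there is ONE chain of exactly `μ/2` double points, then a
# smooth point — `z² = a(u₁,…,uₙ)`, `n ≥ 3`, every field of characteristic 2

HONEST FRAMING. Everything here is OURS: theorems about route WildCones' own TYPED point-blow-up dynamics
(`Theorems/WildConesClassicalRegimesDefs.lean`) and the seat's invariant `milnorEmbDim` (p498937). It is the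
every-dimension form of the seat's gen-2 threefold file `…ThreefoldsCharTwoSingularBranch.lean` (p481799),
assembled from closure (`hypersurface_regime_step`, p501990), existence of the near double point
(`hypersurface_exists_double_successor`, p505045) and the run bound (`hypersurface_two_mul_add_two_le_mu`,
p501990). NOTHING here is a statement of the manuscript [Hironaka2017]; no FACT-LIST premise; AI review is
weaker than expert review. Cell res-hironaka (LADDER-RESOLUTION rung L, D-0089), slot W4.6, seat
res-L1-s46-pv-4 (gen 3); host route `WildCones`, crux `ClassicalRegimes` (stmt-ResolutionOfSingularities-16884;
proved).

WHAT IS PROVED (`n ≥ 3`, every field of characteristic `2`):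

* `hypersurface_exists_singularBranch` — from an isolated double state `c₀` with `e(c₀) = 1`, a chart word
  and a translation word along which every state `m` with `2m + 2 ≤ μ(c₀)` is an isolated double point with
  `e = 1` and `μ + 2m = μ(c₀)`.
* `hypersurface_singularBranch_exact` — and the state `μ(c₀)/2` of that branch is NOT a double point but
  carries a linear cleaned monomial (smooth). With `hypersurface_smooth_le_half` (every branch smooth by
  step `(μ+1)/2`) and `hypersurface_nearPoint_unique'` (at most one near double point, p503790): the
  infinitely-near double points above `c₀` form ONE CHAIN of length exactly `μ(c₀)/2 − 1`, and the
  point-blow-up resolution tree has depth exactly `μ(c₀)/2` — it replaces the role of the LENGTH of the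
  procedure of Th. 16.13 p.87 L25–L28 in this regime, NOT a statement of the manuscript.

References: G.-M. Greuel, G. Pfister, J. Algebra 689 (2026) [GreuelPfister2026] (context); H. Hironaka, ms.
2017 [Hironaka2017] Th. 16.13 p.87 — role replaced only, under adjudication.
-/

noncomputable section

-- single-problem summit: the doubled namespace component `ResolutionOfSingularities` is forced
set_option linter.dupNamespace false

open scoped BigOperators Classical

open MvPowerSeries IsLocalRing

open Literature.AlgebraicGeometry.Resolution

namespace Summit.ResolutionOfSingularities.ResolutionOfSingularities.Theorems

namespace CampaignW46.HypersurfacesCharTwo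

open WildCones WildCones.MuDropCharTwoOrdP ThreefoldsCharTwo

variable {κ : Type} [Field κ] {n : ℕ}

-- adapted from Theorems/WildConesCampaignW46ThreefoldsCharTwoSingularBranch.lean (n = 3)

/-- [OURS · L1 W4.6 rung (ii) at `p = 2`, every dimension; NOT a statement of the manuscript] **THE
SINGULAR BRANCH EXISTS** (`z² = a(u₁,…,uₙ)`, `n ≥ 3`, any field of characteristic `2`): from an isolated
double point `c₀` with curvilinear Milnor algebra (`e(c₀) = 1`) there are a chart word `i` and a
translation word `t` along which every state `m` with `2m + 2 ≤ μ(c₀)` is an isolated double point of the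
regime with `e = 1` and `μ(state m) + 2m = μ(c₀)`: at each stage with `μ ≥ 4` the (unique) infinitely-near
double point exists (`hypersurface_exists_double_successor`) and is chosen; the regime is kept by
`hypersurface_regime_step`. (`n = 3`: gen 2's `threefold_exists_singularBranch`.)
[cite: GreuelPfister2026, Thm 3.5 and Cor 3.7] -/
theorem hypersurface_exists_singularBranch [CharP κ 2] (hn : 3 ≤ n) (c₀ : (Fin n → ℕ) → κ)
    (hM₀ : MultP 2 n κ c₀) (hI₀ : Isol 2 n κ c₀) (he₀ : milnorEmbDim 2 n κ c₀ = 1) :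
    ∃ (i : ℕ → Fin n) (t : ℕ → Fin n → κ), ∀ m, 2 * m + 2 ≤ mu 2 n κ c₀ →
      MultP 2 n κ (run 2 n κ c₀ i t m) ∧ Isol 2 n κ (run 2 n κ c₀ i t m) ∧
        milnorEmbDim 2 n κ (run 2 n κ c₀ i t m) = 1 ∧
        mu 2 n κ (run 2 n κ c₀ i t m) + 2 * m = mu 2 n κ c₀ := by
  classical
  have i₀ : Fin n := ⟨0, by omega⟩
  -- a choice of a double successor whenever one exists
  let nxt : ((Fin n → ℕ) → κ) → Fin n × (Fin n → κ) := fun c =>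
    if h : ∃ x : Fin n × (Fin n → κ), MultP 2 n κ (step 2 n κ x.1 x.2 c) then h.choose
    else (i₀, fun _ => 0)
  have hnxt : ∀ c, (∃ (i : Fin n) (τ : Fin n → κ), MultP 2 n κ (step 2 n κ i τ c)) →
      MultP 2 n κ (step 2 n κ (nxt c).1 (nxt c).2 c) := by
    rintro c ⟨i, τ, h⟩
    have hex : ∃ x : Fin n × (Fin n → κ), MultP 2 n κ (step 2 n κ x.1 x.2 c) := ⟨(i, τ), h⟩
    simp only [nxt, dif_pos hex]
    exact hex.choose_spec
  -- the states along the branch, and the words reading them off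
  let s : ℕ → (Fin n → ℕ) → κ := fun m => Nat.rec c₀ (fun _ c => step 2 n κ (nxt c).1 (nxt c).2 c) m
  refine ⟨fun m => (nxt (s m)).1, fun m => (nxt (s m)).2, ?_⟩
  have hrun : ∀ m, run 2 n κ c₀ (fun m => (nxt (s m)).1) (fun m => (nxt (s m)).2) m = s m := by
    intro m
    induction m with
    | zero => rfl
    | succ m ih =>
      change step 2 n κ (nxt (s m)).1 (nxt (s m)).2
          (run 2 n κ c₀ (fun m => (nxt (s m)).1) (fun m => (nxt (s m)).2) m) =
        step 2 n κ (nxt (s m)).1 (nxt (s m)).2 (s m)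
      rw [ih]
  intro m
  rw [hrun m]
  induction m with
  | zero => intro _; exact ⟨hM₀, hI₀, he₀, rfl⟩
  | succ m ih =>
    intro hm
    obtain ⟨hM, hI, he, hμ⟩ := ih (by omega)
    have h4 : 4 ≤ mu 2 n κ (s m) := by omega
    have hM' := hnxt (s m) (hypersurface_exists_double_successor hn (s m) hM hI he h4)
    obtain ⟨hI', hμ', he'⟩ :=
      hypersurface_regime_step (s m) (nxt (s m)).1 (nxt (s m)).2 hM hI (by omega) hM'
    refine ⟨hM', hI', by rw [he', he], ?_⟩
    change mu 2 n κ (step 2 n κ (nxt (s m)).1 (nxt (s m)).2 (s m)) + 2 * (m + 1) = mu 2 n κ c₀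
    omega

/-- [OURS · L1 W4.6 rung (ii) at `p = 2`, every dimension, replaces the ROLE of the LENGTH of the procedure
of Th. 16.13 p.87 L25–L28 in this regime; NOT a statement of the manuscript] **THE SINGULAR BRANCH HAS
EXACTLY `μ/2` DOUBLE POINTS AND IS THEN RESOLVED** (`z² = a(u₁,…,uₙ)`, `n ≥ 3`, any field of
characteristic `2`): from an isolated double point `c₀` with `e(c₀) = 1` there is a chart/translation word
along which the states `0, …, μ(c₀)/2 − 1` are isolated double points of the regime with
`μ(state m) = μ(c₀) − 2m`, and the state `μ(c₀)/2` is NOT a double point but carries a LINEAR cleaned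
monomial (a smooth point of the transform). With `hypersurface_smooth_le_half` (every word is smooth by
step `μ/2`, p501990) and `hypersurface_nearPoint_unique'` (p503790): the point-blow-up resolution tree of
`c₀` is ONE CHAIN of depth EXACTLY `μ(c₀)/2`. (`n = 3`: gen 2's `threefold_singularBranch_exact`.)
[cite: GreuelPfister2026, Thm 3.5 and Cor 3.7] -/
theorem hypersurface_singularBranch_exact [CharP κ 2] (hn : 3 ≤ n) (c₀ : (Fin n → ℕ) → κ)
    (hM₀ : MultP 2 n κ c₀) (hI₀ : Isol 2 n κ c₀) (he₀ : milnorEmbDim 2 n κ c₀ = 1) :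
    ∃ (i : ℕ → Fin n) (t : ℕ → Fin n → κ),
      (∀ m, 2 * m + 2 ≤ mu 2 n κ c₀ →
        MultP 2 n κ (run 2 n κ c₀ i t m) ∧ Isol 2 n κ (run 2 n κ c₀ i t m) ∧
          milnorEmbDim 2 n κ (run 2 n κ c₀ i t m) = 1 ∧
          mu 2 n κ (run 2 n κ c₀ i t m) + 2 * m = mu 2 n κ c₀) ∧
      ¬ MultP 2 n κ (run 2 n κ c₀ i t (mu 2 n κ c₀ / 2)) ∧
      ∃ A, clean 2 n κ (run 2 n κ c₀ i t (mu 2 n κ c₀ / 2)) A ≠ 0 ∧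
        Finset.sum Finset.univ (fun j => A j) = 1 := by
  obtain ⟨i, t, hbr⟩ := hypersurface_exists_singularBranch hn c₀ hM₀ hI₀ he₀
  obtain ⟨⟨k, hk⟩, h2, -⟩ := curvilinear_of_milnorEmbDim_eq_one hM₀ hI₀ he₀
  set M := mu 2 n κ c₀ / 2 with hMdef
  have hMk : M = k := by omega
  -- the state `M` is not a double point: otherwise the prefix `0, …, M` would give `2M + 2 ≤ μ = 2M`
  have hnot : ¬ MultP 2 n κ (run 2 n κ c₀ i t M) := by
    intro hMM
    have hpre : ∀ m ≤ M, MultP 2 n κ (run 2 n κ c₀ i t m) := by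
      intro m hm
      rcases Nat.lt_or_ge m M with hlt | hge
      · exact (hbr m (by omega)).1
      · have : m = M := le_antisymm hm hge
        rw [this]; exact hMM
    have := hypersurface_two_mul_add_two_le_mu c₀ i t hI₀ (by omega) hpre (by omega)
    omega
  refine ⟨i, t, hbr, hnot, exists_linear_of_not_multP ?_ hnot⟩
  -- and it is non-zero: it is the successor of the double point `M - 1` of the branch
  obtain ⟨M', hM'⟩ : ∃ M', M = M' + 1 := ⟨M - 1, by omega⟩
  rw [hM']
  obtain ⟨hMp, -, hep, -⟩ := hbr M' (by omega)
  have hOp : OrdP 2 n κ (run 2 n κ c₀ i t M') := by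
    rw [ordP_iff_milnorEmbDim_add_two_le hMp]
    omega
  exact ser_step_ne_zero_of_ordP _ (i M') (t M') hMp hOp

end CampaignW46.HypersurfacesCharTwo

end Summit.ResolutionOfSingularities.ResolutionOfSingularities.Theorems

end
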